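import Summits.QuantumFields.YangMills.Theorems.FluctuationComparisonRegPrIntLS2BetaFibreGrowth
import HarnessLib

/-!
# LINE g18-1 S2β LAPLACE — THE GROWTH ROW OF THE v8 `ChartPackage` FROM GAP♯ AND (T2)

Crux `stmt-QuantumFields-20520` (`…Theses.UnitScaleTilt.FluctuationComparisonRegPrIntL`); cell `ym3-torus` (HUMAN RULING D-0037 — YM₃ on T³ is ladder rung
R3, not the Clay problem), width seat `ym3-torus-px21` g10; count-neutral helper (`--kind proof --supports stmt-QuantumFields-20520 --as helper`).
Theorems only: 0 `def`, 0 `instance`, 0 `notation`, 0 `sorry`.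

WHAT.  w4-20520 g15's v8 docking of `Lines/semiclassical_s2beta.lean` displays, inside `ChartPackage c dZ dV e ρ Sst V U₀`, the PEANO growth row
`∃ c₁ > 0, ∀ᶠ y in 𝓝 0, c₁‖y‖² ≤ wilsonAction4 (c.Φ (V, σ y)) − wilsonAction4 (c.Φ (V, σ 0))` along the transversal `σ` of the (C3β″) chart.  px11 g10's
✓`…S2BetaFibreGrowth.growth_of_offPivot_orbitDist_le` (p741166) reduces it POINTWISE to GAP♯ + an off-pivot orbit-distance bound, and px21 g10's
✓`…S2BetaTubularChartDockTransversal.exists_tubularHaarChart_pivotAct_transversal` (p741985) supplies that bound EVENTUALLY along `σ` as its row (T2).  This file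
is the three-line knit, in the tokens of the v8 display: ★ `growthRow_of_gap_of_offPivot_transversal` — from GAP♯ at `(V, U₀)` (px11's `hgap` with `hU₀m`,
`hself`), the chart rows `hoff hfib` and the RELATIVE OPENNESS of `{Φ (V, ·) ∈ Sf}` in the carrier (CHART∞ V-c3's row), the local carrier row
`∀ᶠ y in 𝓝 0, σ y ∈ Xc` (w5-20520 g14 WORD 2) with `Continuous σ`, `σ 0 = U₀`, and (T2) verbatim — to the displayed growth row.  Abstract in the chart `(Φ, Xc, Sf)`,
so it docks with `c.Φ`, `{z | c.jac (V, z) ≠ 0}`, `histGood …` by `exact`.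
HONEST: bookkeeping (filters); proves no stub; LAPLACE∕S2β∕crux 20520 NOT proved; rung R3 — NOT d = 4, NOT infinite volume, NOT a mass gap, NOT Clay.
-/

noncomputable section

open MeasureTheory Filter Topology Set Function
open Literature.MathematicalPhysics.QuantumFieldTheory.Balaban1983to89
open Literature.MathematicalPhysics.QuantumFieldTheory.Balaban1983to89.T3ContinuumYM3Torus
open Literature.MathematicalPhysics.QuantumFieldTheory.Balaban1983to89.T3UnitLawDensityEML
open Literature.MathematicalPhysics.QuantumFieldTheory.Balaban1983to89.T3UnitScaleTilt
open Literature.MathematicalPhysics.QuantumFieldTheory.Balaban1983to89.T3TiltDescent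
open Literature.MathematicalPhysics.QuantumFieldTheory.Balaban1983to89.T3ConstrainedMinimiser (fibre)
open Literature.MathematicalPhysics.QuantumFieldTheory.Balaban1983to89.T4Continuum
open scoped Literature.MathematicalPhysics.QuantumFieldTheory.Balaban1983to89.T3OrbitAverage
open Summit.QuantumFields.YangMills.Theorems.FluctuationComparisonRegPrIntLWregChain (iterCentralBond)
open Summit.QuantumFields.YangMills.Theorems.FluctuationComparisonRegPrIntLS2BetaFibreGrowth

namespace Summit.QuantumFields.YangMills.Theorems.FluctuationComparisonRegPrIntLS2BetaChartPackageGrowthRow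

variable (F : T3Family) {J K : ℕ} (hJK : J ≤ K)

/-- ★ **THE v8 `ChartPackage` GROWTH ROW FROM GAP♯ AND (T2)**: at a window datum `V` with minimising history `U₀` (`wilsonAction4 U₀ = m`, self-charted:
`Φ (V, U₀) = U₀`), GAP♯ on the fibre (`hgap`), the chart rows `hoff` ∕ `hfib`, the relative openness of `{z | Φ (V, z) ∈ Sf}` in the carrier `Xc ∋ U₀` with
`U₀ ∈ Sf`, a continuous transversal `σ` through `U₀` that stays in the carrier near `0`, and the (T2) row of the (C3β″) chart give
`∃ c₁ > 0, ∀ᶠ y in 𝓝 0, c₁‖y‖² ≤ wilsonAction4 (Φ (V, σ y)) − wilsonAction4 (Φ (V, σ 0))` with `c₁ := μ′ · c₁^{(T2)}`.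
[cite: Balaban1985Variational, Thm 1 (8)-(10) p.279 and (142) p.299; Balaban1987RG1, (0.4) p.253] -/
theorem growthRow_of_gap_of_offPivot_transversal {Y : Type*} [TopologicalSpace Y] [Zero Y] [Norm Y]
    (Φ : GaugeField (F.P J) 0 (Matrix.specialUnitaryGroup (Fin 2) ℂ) × GaugeField (F.P K) 0 (Matrix.specialUnitaryGroup (Fin 2) ℂ) →
      GaugeField (F.P K) 0 (Matrix.specialUnitaryGroup (Fin 2) ℂ))
    {Sf : Set (GaugeField (F.P K) 0 (Matrix.specialUnitaryGroup (Fin 2) ℂ))}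
    {V : GaugeField (F.P J) 0 (Matrix.specialUnitaryGroup (Fin 2) ℂ)} {m μ' : ℝ} (hμ' : 0 < μ')
    {U₀ : GaugeField (F.P K) 0 (Matrix.specialUnitaryGroup (Fin 2) ℂ)} (hU₀S : U₀ ∈ Sf) (hU₀m : wilsonAction4 U₀ = m) (hself : Φ (V, U₀) = U₀)
    (hgap : ∀ U ∈ fibre F ℰp J K hJK V, U ∈ Sf →
      μ' * (⨅ w : {w : Site (F.P K) 0 → Matrix.specialUnitaryGroup (Fin 2) ℂ |
              ∀ U : GaugeField (F.P K) 0 (Matrix.specialUnitaryGroup (Fin 2) ℂ),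
                descendTo F ℰp J K hJK (GaugeField.gaugeAct w U) = descendTo F ℰp J K hJK U},
            ∑ ℓ : PBond (F.P K) 0,
              dist1 (U ℓ * ((GaugeField.gaugeAct (w : Site (F.P K) 0 → Matrix.specialUnitaryGroup (Fin 2) ℂ) U₀) ℓ)⁻¹) ^ 2)
        ≤ wilsonAction4 U - m)
    {Xc : Set (GaugeField (F.P K) 0 (Matrix.specialUnitaryGroup (Fin 2) ℂ))} (hU₀X : U₀ ∈ Xc)
    (hoff : ∀ z ∈ Xc, ∀ b, (∀ c, iterCentralBond (P := F.P K) (K - J) c ≠ b) → Φ (V, z) b = z b)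
    (hfib : ∀ z ∈ Xc, descendTo F ℰp J K hJK (Φ (V, z)) = V)
    (hOrel : IsOpen ((Subtype.val : Xc → GaugeField (F.P K) 0 (Matrix.specialUnitaryGroup (Fin 2) ℂ)) ⁻¹' {z | Φ (V, z) ∈ Sf}))
    {σ : Y → GaugeField (F.P K) 0 (Matrix.specialUnitaryGroup (Fin 2) ℂ)} (hσc : Continuous σ) (hσ0 : σ 0 = U₀)
    (hσX : ∀ᶠ y in 𝓝 (0 : Y), σ y ∈ Xc)
    (hT2 : ∃ c₁ : ℝ, 0 < c₁ ∧ ∀ᶠ y in 𝓝 (0 : Y),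
        c₁ * ‖y‖ ^ 2 ≤ ⨅ w : {w : Site (F.P K) 0 → Matrix.specialUnitaryGroup (Fin 2) ℂ |
              ∀ U : GaugeField (F.P K) 0 (Matrix.specialUnitaryGroup (Fin 2) ℂ),
                descendTo F ℰp J K hJK (GaugeField.gaugeAct w U) = descendTo F ℰp J K hJK U},
            ∑ ℓ ∈ Finset.univ.filter (fun ℓ : PBond (F.P K) 0 => ∀ c, iterCentralBond (P := F.P K) (K - J) c ≠ ℓ),
              dist1 (σ y ℓ * ((GaugeField.gaugeAct (w : Site (F.P K) 0 → Matrix.specialUnitaryGroup (Fin 2) ℂ) U₀) ℓ)⁻¹) ^ 2) :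
    ∃ c₁ : ℝ, 0 < c₁ ∧ ∀ᶠ y in 𝓝 (0 : Y), c₁ * ‖y‖ ^ 2 ≤ wilsonAction4 (Φ (V, σ y)) - wilsonAction4 (Φ (V, σ 0)) := by
  obtain ⟨c₁, hc₁, hev⟩ := hT2
  -- the chart value stays in `Sf` near `0`: relative openness in the carrier + the local carrier row + continuity of `σ`
  obtain ⟨t, hto, ht⟩ := isOpen_induced_iff.1 hOrel
  have hU₀t : U₀ ∈ t := by
    have h1 : (⟨U₀, hU₀X⟩ : Xc) ∈ (Subtype.val : Xc → GaugeField (F.P K) 0 (Matrix.specialUnitaryGroup (Fin 2) ℂ)) ⁻¹' {z | Φ (V, z) ∈ Sf} := by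
      show Φ (V, U₀) ∈ Sf
      rw [hself]; exact hU₀S
    rw [← ht] at h1
    exact h1
  have hσt : ∀ᶠ y in 𝓝 (0 : Y), σ y ∈ t := by
    have h1 : σ ⁻¹' t ∈ 𝓝 (0 : Y) := hσc.continuousAt.preimage_mem_nhds (by rw [hσ0]; exact hto.mem_nhds hU₀t)
    exact h1
  have hσS : ∀ᶠ y in 𝓝 (0 : Y), Φ (V, σ y) ∈ Sf := by
    filter_upwards [hσt, hσX] with y h1 h2
    have h3 : (⟨σ y, h2⟩ : Xc) ∈ (Subtype.val : Xc → GaugeField (F.P K) 0 (Matrix.specialUnitaryGroup (Fin 2) ℂ)) ⁻¹' t := h1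
    rw [ht] at h3
    exact h3
  refine ⟨μ' * c₁, mul_pos hμ' hc₁, ?_⟩
  filter_upwards [hσX, hσS, hev] with y h1 h2 h3
  have h := growth_of_offPivot_orbitDist_le F hJK Φ hμ' hgap hoff hfib h1 h2 h3
  rw [hσ0, hself, hU₀m, mul_assoc]
  linarith

end Summit.QuantumFields.YangMills.Theorems.FluctuationComparisonRegPrIntLS2BetaChartPackageGrowthRow

end
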